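import Mathlib
import Summits.NavierStokesRegularity.NavierStokesRegularity.Theorems.EulerZoomLiouvillePowerGaugeEulerLiouvilleQVorticityEpsilon
import HarnessLib

/-!
# The `q`-power of the vorticity along classical Euler flows with a moving weight — the identity on `ℝ³`
# (helper of the DSS vorticity-decay stratum of the crux `EulerZoomLiouville.PowerGaugeEulerLiouville`,
# route №10, item stmt-NavierStokesRegularity-19832)

Helper file (theorems only; `--supports stmt-NavierStokesRegularity-19832`). Seat ns-typeII-p3 (cell
ns-regularity-ideate §B, D-0081). Sequel of `…QVorticityEpsilon.lean`: the outer cut-off radius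
`R = n + 1 → ∞` in `integral_cutoff_weight_rpow_sub_eq` (the flux term is `O(1/R)` against
`sup_σ ∫|ω(σ)|^q < ∞`; dominated convergence in `σ`). Result (`integral_weight_rpow_sub_eq`): for a
classical Euler flow on `[0, T]` with `‖u‖, ‖∇u‖ ≤ B`, a jointly smooth weight `Θ` with `|Θ| ≤ 1`,
`|∂ₜΘ|, ‖DΘ‖ ≤ M`, an exponent `q > 0` and `∫|ω(σ)|^q ≤ N` on `[0, T]`,
`½∫Θ(T)²|ω(T)|^q − ½∫Θ(0)²|ω(0)|^q = ∫₀ᵀ (∫(q/2)Θ²|ω|^q⟪ξ, Du ξ⟫ + ∫Θ(∂ₜΘ + DΘ[u])|ω|^q) dσ`,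
`ξ = ω/|ω|` — the weighted `q`-ENSTROPHY BALANCE: stretching `⟪ξ, Sξ⟫|ω|^q` plus transport through the
moving weight. Also: the stretching density `|w|^q⟪ŵ, Aŵ⟫` is jointly continuous in `(w, A)`
(`continuous_qstretch`) and bounded by `‖A‖ |w|^q` (`abs_qstretch_le`).

WHAT THIS IS NOT: not NS, not the crux — a calculus identity for classical Euler flows (physical-variable
form of Chae–Tsai, MRL 21 (2014) §2, eq. after (2.12)). [folklore]
-/

noncomputable section

-- the summit and its single problem share the name `NavierStokesRegularity` (D-0017 nested layout)
set_option linter.dupNamespace false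

open Set Function Filter Topology MeasureTheory Metric
open scoped NNReal ENNReal InnerProductSpace RealInnerProductSpace

namespace Summit.NavierStokesRegularity.NavierStokesRegularity.Theorems.PowerGaugeEulerLiouville.VorticityDecay

open Literature.Analysis Literature.Analysis.FluidPDE
open Summit.NavierStokesRegularity.NavierStokesRegularity.Theorems.PowerGaugeEulerLiouville.VorticitySupport

/-! ## The stretching density `|w|^q ⟪ŵ, A ŵ⟫` -/

/-- `‖ŵ‖ ≤ 1` for `ŵ = |w|⁻¹ w`. [folklore] -/
theorem norm_smul_inv_norm_le (w : EuclideanSpace ℝ (Fin 3)) : ‖‖w‖⁻¹ • w‖ ≤ 1 := by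
  rw [norm_smul, norm_inv, norm_norm]
  exact inv_mul_le_one

/-- **Bound**: `| |w|^q ⟪ŵ, A ŵ⟫ | ≤ ‖A‖ |w|^q`. [folklore] -/
theorem abs_qstretch_le (q : ℝ) (w : EuclideanSpace ℝ (Fin 3))
    (A : (EuclideanSpace ℝ (Fin 3)) →L[ℝ] (EuclideanSpace ℝ (Fin 3))) :
    |‖w‖ ^ q * ⟪‖w‖⁻¹ • w, A (‖w‖⁻¹ • w)⟫| ≤ ‖A‖ * ‖w‖ ^ q := by
  rw [abs_mul, abs_of_nonneg (Real.rpow_nonneg (norm_nonneg _) _), mul_comm]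
  gcongr
  have h1 := norm_smul_inv_norm_le w
  calc |⟪‖w‖⁻¹ • w, A (‖w‖⁻¹ • w)⟫| ≤ ‖‖w‖⁻¹ • w‖ * ‖A (‖w‖⁻¹ • w)‖ := abs_real_inner_le_norm _ _
    _ ≤ 1 * (‖A‖ * 1) := by
        refine mul_le_mul h1 ((A.le_opNorm _).trans ?_) (norm_nonneg _) zero_le_one
        exact mul_le_mul_of_nonneg_left h1 (norm_nonneg _)
    _ = ‖A‖ := by ring

/-- **Joint continuity of the stretching density** `(w, A) ↦ |w|^q ⟪ŵ, A ŵ⟫` (`q > 0`; at `w = 0` it is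
squeezed by `‖A‖ |w|^q → 0`). [folklore] -/
theorem continuous_qstretch {q : ℝ} (hq : 0 < q) :
    Continuous (fun z : (EuclideanSpace ℝ (Fin 3)) × ((EuclideanSpace ℝ (Fin 3)) →L[ℝ] (EuclideanSpace ℝ (Fin 3))) =>
      ‖z.1‖ ^ q * ⟪‖z.1‖⁻¹ • z.1, z.2 (‖z.1‖⁻¹ • z.1)⟫) := by
  rw [continuous_iff_continuousAt]
  rintro ⟨w, A⟩
  by_cases hw : w = 0
  · subst hw
    -- squeeze at `w = 0`
    have h0 : (‖(0 : EuclideanSpace ℝ (Fin 3))‖ ^ q *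
        ⟪‖(0 : EuclideanSpace ℝ (Fin 3))‖⁻¹ • (0 : EuclideanSpace ℝ (Fin 3)),
          A (‖(0 : EuclideanSpace ℝ (Fin 3))‖⁻¹ • (0 : EuclideanSpace ℝ (Fin 3)))⟫) = 0 := by simp
    show Tendsto _ _ (𝓝 (‖(0 : EuclideanSpace ℝ (Fin 3))‖ ^ q *
        ⟪‖(0 : EuclideanSpace ℝ (Fin 3))‖⁻¹ • (0 : EuclideanSpace ℝ (Fin 3)),
          A (‖(0 : EuclideanSpace ℝ (Fin 3))‖⁻¹ • (0 : EuclideanSpace ℝ (Fin 3)))⟫))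
    rw [h0]
    have hc : Continuous fun z : (EuclideanSpace ℝ (Fin 3)) ×
        ((EuclideanSpace ℝ (Fin 3)) →L[ℝ] (EuclideanSpace ℝ (Fin 3))) => ‖z.2‖ * ‖z.1‖ ^ q :=
      continuous_snd.norm.mul (continuous_fst.norm.rpow_const fun _ => Or.inr hq.le)
    have hlim := hc.tendsto ((0 : EuclideanSpace ℝ (Fin 3)), A)
    simp only [norm_zero, Real.zero_rpow hq.ne', mul_zero] at hlim
    exact squeeze_zero_norm (fun z => by rw [Real.norm_eq_abs]; exact abs_qstretch_le q z.1 z.2) hlim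
  · -- away from `w = 0`: a product of continuous functions
    have hn : ‖w‖ ≠ 0 := norm_ne_zero_iff.2 hw
    have e : ∀ z : (EuclideanSpace ℝ (Fin 3)) × ((EuclideanSpace ℝ (Fin 3)) →L[ℝ] (EuclideanSpace ℝ (Fin 3))),
        ‖z.1‖ ^ q * ⟪‖z.1‖⁻¹ • z.1, z.2 (‖z.1‖⁻¹ • z.1)⟫ =
          ‖z.1‖ ^ q * (‖z.1‖⁻¹ * ‖z.1‖⁻¹) * ⟪z.1, z.2 z.1⟫ := by
      intro z
      rw [map_smul, inner_smul_left, inner_smul_right]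
      simp only [conj_trivial]
      ring
    simp_rw [e]
    refine ((ContinuousAt.mul ?_ ?_).mul ?_)
    · exact (continuous_fst.norm.continuousAt).rpow_const (Or.inl hn)
    · exact (continuous_fst.norm.continuousAt.inv₀ hn).mul (continuous_fst.norm.continuousAt.inv₀ hn)
    · exact (continuous_fst.inner (continuous_snd.clm_apply continuous_fst)).continuousAt

section Whole

variable {T : ℝ} {v : ℝ → (EuclideanSpace ℝ (Fin 3)) → (EuclideanSpace ℝ (Fin 3))}
  {p : ℝ → (EuclideanSpace ℝ (Fin 3)) → ℝ} {Θ : ℝ → (EuclideanSpace ℝ (Fin 3)) → ℝ}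

/-- **The weighted `q`-enstrophy balance on `ℝ³`.** For a classical Euler flow on `[0, T]` (`T > 0`)
with `‖u‖, ‖∇u‖ ≤ B`, a jointly smooth weight `Θ` with `|Θ| ≤ 1`, `|∂ₜΘ|, ‖DΘ‖ ≤ M`, an exponent
`q > 0` and `∫|curl u(σ)|^q ≤ N` on `[0, T]` (`|curl u(σ)|^q` integrable):
`½∫Θ(T)²|ω(T)|^q − ½∫Θ(0)²|ω(0)|^q
  = ∫_{σ∈(0,T)} (∫ (q/2)Θ² |ω|^q⟪ξ, Du ξ⟫ + ∫ Θ(∂ₜΘ + DΘ[u]) |ω|^q) dσ`, `ξ = ω/|ω|`. [folklore] -/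
theorem integral_weight_rpow_sub_eq (hT : 0 < T) (hv : IsClassicalNSSolutionOn (Icc 0 T) 0 0 v p)
    {B : ℝ} (hB : ∀ σ ∈ Icc 0 T, ∀ y, ‖v σ y‖ ≤ B ∧ ‖fderiv ℝ (v σ) y‖ ≤ B)
    (hΘ : IsSmoothSpaceTimeOn (Icc 0 T) Θ) {M : ℝ}
    (hΘM : ∀ σ ∈ Icc 0 T, ∀ y, |Θ σ y| ≤ 1 ∧
      |FluidPDE.timeDerivWithin (Icc 0 T) Θ σ y| ≤ M ∧ ‖fderiv ℝ (Θ σ) y‖ ≤ M)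
    {q : ℝ} (hq : 0 < q) {N : ℝ}
    (hLq : ∀ σ ∈ Icc 0 T, Integrable (fun y => ‖curl (v σ) y‖ ^ q) ∧ ∫ y, ‖curl (v σ) y‖ ^ q ≤ N) :
    2⁻¹ * (∫ x, Θ T x ^ 2 * ‖curl (v T) x‖ ^ q) - 2⁻¹ * (∫ x, Θ 0 x ^ 2 * ‖curl (v 0) x‖ ^ q) =
      ∫ σ in Ioo 0 T, ((∫ x, (q / 2 * Θ σ x ^ 2) * (‖curl (v σ) x‖ ^ q *
          ⟪‖curl (v σ) x‖⁻¹ • curl (v σ) x, fderiv ℝ (v σ) x (‖curl (v σ) x‖⁻¹ • curl (v σ) x)⟫)) +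
        ∫ x, (Θ σ x * (FluidPDE.timeDerivWithin (Icc 0 T) Θ σ x + fderiv ℝ (Θ σ) x (v σ x))) *
          ‖curl (v σ) x‖ ^ q) := by
  have hS : UniqueDiffOn ℝ (Icc 0 T) := uniqueDiffOn_Icc hT
  have hTm : T ∈ Icc 0 T := ⟨hT.le, le_rfl⟩
  have h0m : (0 : ℝ) ∈ Icc 0 T := ⟨le_rfl, hT.le⟩
  obtain ⟨C, hC0, hC⟩ := exists_norm_fderiv_cutoff_le (E := (EuclideanSpace ℝ (Fin 3)))
  have hB0 : 0 ≤ B := (norm_nonneg _).trans (hB 0 h0m 0).1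
  have hM0 : 0 ≤ M := (norm_nonneg _).trans (hΘM 0 h0m 0).2.2
  have hN0 : 0 ≤ N := (integral_nonneg fun y => Real.rpow_nonneg (norm_nonneg _) _).trans (hLq 0 h0m).2
  -- continuity data
  have hvc : ∀ σ ∈ Icc 0 T, Continuous (v σ) := fun σ hσ => (hv.contDiff_velocity hσ).continuous
  have hωc : ∀ σ ∈ Icc 0 T, Continuous (curl (v σ)) := fun σ hσ =>
    (contDiff_curl (n := 0) ((hv.contDiff_velocity hσ).of_le (by norm_cast))).continuous
  have hAc : ∀ σ ∈ Icc 0 T, Continuous (fun x => fderiv ℝ (v σ) x) := fun σ hσ =>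
    (hv.contDiff_velocity hσ).continuous_fderiv (by simp)
  have hΘc : ∀ σ ∈ Icc 0 T, Continuous (Θ σ) := fun σ hσ => (hΘ.contDiff_slice hσ).continuous
  have hmc : ∀ σ ∈ Icc 0 T, Continuous (fun x =>
      FluidPDE.timeDerivWithin (Icc 0 T) Θ σ x + fderiv ℝ (Θ σ) x (v σ x)) := fun σ hσ =>
    ((hΘ.timeDerivWithin hS).contDiff_slice hσ).continuous.add
      (((hΘ.contDiff_slice hσ).continuous_fderiv (by simp)).clm_apply (hvc σ hσ))
  have hωqc : ∀ σ ∈ Icc 0 T, Continuous (fun x => ‖curl (v σ) x‖ ^ q) := fun σ hσ =>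
    (hωc σ hσ).norm.rpow_const fun _ => Or.inr hq.le
  have hstc : ∀ σ ∈ Icc 0 T, Continuous (fun x => ‖curl (v σ) x‖ ^ q *
      ⟪‖curl (v σ) x‖⁻¹ • curl (v σ) x, fderiv ℝ (v σ) x (‖curl (v σ) x‖⁻¹ • curl (v σ) x)⟫) := by
    intro σ hσ
    have h := (continuous_qstretch hq).comp ((hωc σ hσ).prodMk (hAc σ hσ))
    exact h.congr fun x => rfl
  -- pointwise bounds
  have hm : ∀ σ ∈ Icc 0 T, ∀ x,
      |FluidPDE.timeDerivWithin (Icc 0 T) Θ σ x + fderiv ℝ (Θ σ) x (v σ x)| ≤ M + M * B := by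
    intro σ hσ x
    refine (abs_add_le _ _).trans (add_le_add (hΘM σ hσ x).2.1 ?_)
    rw [← Real.norm_eq_abs]
    exact ((fderiv ℝ (Θ σ) x).le_opNorm _).trans (mul_le_mul (hΘM σ hσ x).2.2 (hB σ hσ x).1
      (norm_nonneg _) hM0)
  have hΘ2 : ∀ σ ∈ Icc 0 T, ∀ x, |Θ σ x ^ 2| ≤ 1 := fun σ hσ x => by
    rw [abs_pow]; exact pow_le_one₀ (abs_nonneg _) (hΘM σ hσ x).1
  -- integrability of the limit integrands (bounded continuous × integrable)
  have hI0 : ∀ σ ∈ Icc 0 T, Integrable (fun x => Θ σ x ^ 2 * ‖curl (v σ) x‖ ^ q) := fun σ hσ =>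
    (hLq σ hσ).1.bdd_mul ((hΘc σ hσ).pow 2).aestronglyMeasurable
      (Eventually.of_forall fun x => by rw [Real.norm_eq_abs]; exact hΘ2 σ hσ x)
  have hIst : ∀ σ ∈ Icc 0 T, Integrable (fun x => ‖curl (v σ) x‖ ^ q *
      ⟪‖curl (v σ) x‖⁻¹ • curl (v σ) x, fderiv ℝ (v σ) x (‖curl (v σ) x‖⁻¹ • curl (v σ) x)⟫) := by
    intro σ hσ
    refine Integrable.mono' ((hLq σ hσ).1.const_mul B) (hstc σ hσ).aestronglyMeasurable
      (Eventually.of_forall fun x => ?_)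
    rw [Real.norm_eq_abs]
    exact (abs_qstretch_le q _ _).trans (mul_le_mul_of_nonneg_right (hB σ hσ x).2
      (Real.rpow_nonneg (norm_nonneg _) _))
  have hI1 : ∀ σ ∈ Icc 0 T, Integrable (fun x => (q / 2 * Θ σ x ^ 2) * (‖curl (v σ) x‖ ^ q *
      ⟪‖curl (v σ) x‖⁻¹ • curl (v σ) x, fderiv ℝ (v σ) x (‖curl (v σ) x‖⁻¹ • curl (v σ) x)⟫)) :=
    fun σ hσ => (hIst σ hσ).bdd_mul ((continuous_const.mul ((hΘc σ hσ).pow 2)).aestronglyMeasurable)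
      (Eventually.of_forall fun x => by
        rw [Real.norm_eq_abs, abs_mul, abs_of_pos (by positivity : (0 : ℝ) < q / 2)]
        exact mul_le_mul_of_nonneg_left (hΘ2 σ hσ x) (by positivity))
  have hI2 : ∀ σ ∈ Icc 0 T, Integrable (fun x =>
      (Θ σ x * (FluidPDE.timeDerivWithin (Icc 0 T) Θ σ x + fderiv ℝ (Θ σ) x (v σ x))) *
        ‖curl (v σ) x‖ ^ q) :=
    fun σ hσ => (hLq σ hσ).1.bdd_mul (((hΘc σ hσ).mul (hmc σ hσ)).aestronglyMeasurable)
      (Eventually.of_forall fun x => by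
        rw [Real.norm_eq_abs, abs_mul]
        exact mul_le_mul (hΘM σ hσ x).1 (hm σ hσ x) (abs_nonneg _) zero_le_one)
  -- the identity at radius `n + 1`
  have hid := fun n : ℕ => integral_cutoff_weight_rpow_sub_eq hT hv hB hΘ hΘM hq (R := (n : ℝ) + 1)
    (by positivity)
  -- the left-hand sides converge (`χ_{n+1} → 1`, dominated by the integrable `Θ²|ω|^q`)
  have hL : Tendsto (fun n : ℕ =>
      2⁻¹ * (∫ x, cutoff ((n : ℝ) + 1) x * (Θ T x ^ 2 * ‖curl (v T) x‖ ^ q)) -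
        2⁻¹ * (∫ x, cutoff ((n : ℝ) + 1) x * (Θ 0 x ^ 2 * ‖curl (v 0) x‖ ^ q))) atTop
      (𝓝 (2⁻¹ * (∫ x, Θ T x ^ 2 * ‖curl (v T) x‖ ^ q) - 2⁻¹ * (∫ x, Θ 0 x ^ 2 * ‖curl (v 0) x‖ ^ q))) :=
    ((tendsto_integral_cutoff_mul (hI0 T hTm)).const_mul _).sub
      ((tendsto_integral_cutoff_mul (hI0 0 h0m)).const_mul _)
  -- the right-hand integrands
  set H : ℕ → ℝ → ℝ := fun n σ =>
    (2⁻¹ * (∫ x, fderiv ℝ (cutoff ((n : ℝ) + 1)) x (v σ x) * (Θ σ x ^ 2 * ‖curl (v σ) x‖ ^ q)) +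
      ((∫ x, cutoff ((n : ℝ) + 1) x * (q / 2 * Θ σ x ^ 2) * (‖curl (v σ) x‖ ^ q *
          ⟪‖curl (v σ) x‖⁻¹ • curl (v σ) x, fderiv ℝ (v σ) x (‖curl (v σ) x‖⁻¹ • curl (v σ) x)⟫)) +
        ∫ x, cutoff ((n : ℝ) + 1) x * (Θ σ x *
            (FluidPDE.timeDerivWithin (Icc 0 T) Θ σ x + fderiv ℝ (Θ σ) x (v σ x))) *
          ‖curl (v σ) x‖ ^ q)) with hH
  -- reassociated forms of the two source pieces
  have e1 : ∀ (n : ℕ) σ, (∫ x, cutoff ((n : ℝ) + 1) x * (q / 2 * Θ σ x ^ 2) * (‖curl (v σ) x‖ ^ q *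
      ⟪‖curl (v σ) x‖⁻¹ • curl (v σ) x, fderiv ℝ (v σ) x (‖curl (v σ) x‖⁻¹ • curl (v σ) x)⟫)) =
      ∫ x, cutoff ((n : ℝ) + 1) x * ((q / 2 * Θ σ x ^ 2) * (‖curl (v σ) x‖ ^ q *
        ⟪‖curl (v σ) x‖⁻¹ • curl (v σ) x, fderiv ℝ (v σ) x (‖curl (v σ) x‖⁻¹ • curl (v σ) x)⟫)) :=
    fun n σ => integral_congr_ae (Eventually.of_forall fun x => by ring)
  have e2 : ∀ (n : ℕ) σ, (∫ x, cutoff ((n : ℝ) + 1) x * (Θ σ x *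
      (FluidPDE.timeDerivWithin (Icc 0 T) Θ σ x + fderiv ℝ (Θ σ) x (v σ x))) * ‖curl (v σ) x‖ ^ q) =
      ∫ x, cutoff ((n : ℝ) + 1) x * ((Θ σ x *
        (FluidPDE.timeDerivWithin (Icc 0 T) Θ σ x + fderiv ℝ (Θ σ) x (v σ x))) * ‖curl (v σ) x‖ ^ q) :=
    fun n σ => integral_congr_ae (Eventually.of_forall fun x => by ring)
  -- the flux term is `O(1/(n+1))`
  have hflux : ∀ (n : ℕ), ∀ σ ∈ Icc 0 T,
      |∫ x, fderiv ℝ (cutoff ((n : ℝ) + 1)) x (v σ x) * (Θ σ x ^ 2 * ‖curl (v σ) x‖ ^ q)| ≤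
        C / ((n : ℝ) + 1) * B * N := by
    intro n σ hσ
    have hR : (0 : ℝ) < (n : ℝ) + 1 := by positivity
    have hpt : ∀ x, ‖fderiv ℝ (cutoff ((n : ℝ) + 1)) x (v σ x) * (Θ σ x ^ 2 * ‖curl (v σ) x‖ ^ q)‖ ≤
        C / ((n : ℝ) + 1) * B * ‖curl (v σ) x‖ ^ q := by
      intro x
      have hq0 : 0 ≤ ‖curl (v σ) x‖ ^ q := Real.rpow_nonneg (norm_nonneg _) _
      rw [norm_mul, norm_mul, Real.norm_of_nonneg (sq_nonneg _), Real.norm_of_nonneg hq0]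
      have h1 : ‖fderiv ℝ (cutoff ((n : ℝ) + 1)) x (v σ x)‖ ≤ C / ((n : ℝ) + 1) * B :=
        ((fderiv ℝ (cutoff ((n : ℝ) + 1)) x).le_opNorm _).trans (mul_le_mul (hC _ hR x) (hB σ hσ x).1
          (norm_nonneg _) (div_nonneg hC0 hR.le))
      have h2 : Θ σ x ^ 2 ≤ 1 := (le_abs_self _).trans (hΘ2 σ hσ x)
      calc ‖fderiv ℝ (cutoff ((n : ℝ) + 1)) x (v σ x)‖ * (Θ σ x ^ 2 * ‖curl (v σ) x‖ ^ q)
          ≤ (C / ((n : ℝ) + 1) * B) * (1 * ‖curl (v σ) x‖ ^ q) :=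
            mul_le_mul h1 (mul_le_mul_of_nonneg_right h2 hq0) (by positivity) (by positivity)
        _ = C / ((n : ℝ) + 1) * B * ‖curl (v σ) x‖ ^ q := by ring
    have h := norm_integral_le_of_norm_le ((hLq σ hσ).1.const_mul (C / ((n : ℝ) + 1) * B))
      (Eventually.of_forall hpt)
    rw [Real.norm_eq_abs, integral_const_mul] at h
    exact h.trans (mul_le_mul_of_nonneg_left (hLq σ hσ).2 (by positivity))
  -- bounds for the source pieces
  have hsrc1 : ∀ (n : ℕ), ∀ σ ∈ Icc 0 T,
      |∫ x, cutoff ((n : ℝ) + 1) x * ((q / 2 * Θ σ x ^ 2) * (‖curl (v σ) x‖ ^ q *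
        ⟪‖curl (v σ) x‖⁻¹ • curl (v σ) x, fderiv ℝ (v σ) x (‖curl (v σ) x‖⁻¹ • curl (v σ) x)⟫))| ≤
        q / 2 * B * N := by
    intro n σ hσ
    have hpt : ∀ x, ‖cutoff ((n : ℝ) + 1) x * ((q / 2 * Θ σ x ^ 2) * (‖curl (v σ) x‖ ^ q *
        ⟪‖curl (v σ) x‖⁻¹ • curl (v σ) x, fderiv ℝ (v σ) x (‖curl (v σ) x‖⁻¹ • curl (v σ) x)⟫))‖ ≤
        q / 2 * B * ‖curl (v σ) x‖ ^ q := by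
      intro x
      rw [norm_mul, norm_mul, Real.norm_eq_abs, Real.norm_eq_abs, Real.norm_eq_abs,
        abs_mul, abs_of_pos (by positivity : (0 : ℝ) < q / 2)]
      have h3 := (abs_qstretch_le q (curl (v σ) x) (fderiv ℝ (v σ) x)).trans
        (mul_le_mul_of_nonneg_right (hB σ hσ x).2 (Real.rpow_nonneg (norm_nonneg _) _))
      calc _ ≤ 1 * ((q / 2 * 1) * (B * ‖curl (v σ) x‖ ^ q)) :=
            mul_le_mul (abs_cutoff_le_one _ _) (mul_le_mul (mul_le_mul_of_nonneg_left (hΘ2 σ hσ x)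
              (by positivity)) h3 (abs_nonneg _) (by positivity)) (by positivity) zero_le_one
        _ = q / 2 * B * ‖curl (v σ) x‖ ^ q := by ring
    have h := norm_integral_le_of_norm_le ((hLq σ hσ).1.const_mul (q / 2 * B)) (Eventually.of_forall hpt)
    rw [Real.norm_eq_abs, integral_const_mul] at h
    exact h.trans (mul_le_mul_of_nonneg_left (hLq σ hσ).2 (by positivity))
  have hsrc2 : ∀ (n : ℕ), ∀ σ ∈ Icc 0 T,
      |∫ x, cutoff ((n : ℝ) + 1) x * ((Θ σ x *
        (FluidPDE.timeDerivWithin (Icc 0 T) Θ σ x + fderiv ℝ (Θ σ) x (v σ x))) * ‖curl (v σ) x‖ ^ q)| ≤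
        (M + M * B) * N := by
    intro n σ hσ
    have hpt : ∀ x, ‖cutoff ((n : ℝ) + 1) x * ((Θ σ x *
        (FluidPDE.timeDerivWithin (Icc 0 T) Θ σ x + fderiv ℝ (Θ σ) x (v σ x))) * ‖curl (v σ) x‖ ^ q)‖ ≤
        (M + M * B) * ‖curl (v σ) x‖ ^ q := by
      intro x
      have hq0 : 0 ≤ ‖curl (v σ) x‖ ^ q := Real.rpow_nonneg (norm_nonneg _) _
      rw [norm_mul, norm_mul, Real.norm_eq_abs, Real.norm_eq_abs, Real.norm_of_nonneg hq0, abs_mul]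
      calc _ ≤ 1 * ((1 * (M + M * B)) * ‖curl (v σ) x‖ ^ q) :=
            mul_le_mul (abs_cutoff_le_one _ _) (mul_le_mul_of_nonneg_right
              (mul_le_mul (hΘM σ hσ x).1 (hm σ hσ x) (abs_nonneg _) zero_le_one) hq0)
              (by positivity) zero_le_one
        _ = (M + M * B) * ‖curl (v σ) x‖ ^ q := by ring
    have h := norm_integral_le_of_norm_le ((hLq σ hσ).1.const_mul (M + M * B)) (Eventually.of_forall hpt)
    rw [Real.norm_eq_abs, integral_const_mul] at h
    exact h.trans (mul_le_mul_of_nonneg_left (hLq σ hσ).2 (by positivity))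
  -- pointwise limit in `σ`
  have hHlim : ∀ σ ∈ Ioo 0 T, Tendsto (fun n => H n σ) atTop
      (𝓝 ((∫ x, (q / 2 * Θ σ x ^ 2) * (‖curl (v σ) x‖ ^ q *
          ⟪‖curl (v σ) x‖⁻¹ • curl (v σ) x, fderiv ℝ (v σ) x (‖curl (v σ) x‖⁻¹ • curl (v σ) x)⟫)) +
        ∫ x, (Θ σ x * (FluidPDE.timeDerivWithin (Icc 0 T) Θ σ x + fderiv ℝ (Θ σ) x (v σ x))) *
          ‖curl (v σ) x‖ ^ q)) := by
    intro σ hσ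
    have hσ' : σ ∈ Icc 0 T := Ioo_subset_Icc_self hσ
    have hf : Tendsto (fun n : ℕ => 2⁻¹ * ∫ x, fderiv ℝ (cutoff ((n : ℝ) + 1)) x (v σ x) *
        (Θ σ x ^ 2 * ‖curl (v σ) x‖ ^ q)) atTop (𝓝 0) := by
      have hb : Tendsto (fun n : ℕ => 2⁻¹ * (C / ((n : ℝ) + 1) * B * N)) atTop (𝓝 0) := by
        have h1 : Tendsto (fun n : ℕ => C / ((n : ℝ) + 1)) atTop (𝓝 0) :=
          tendsto_const_nhds.div_atTop (tendsto_natCast_atTop_atTop.atTop_add tendsto_const_nhds)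
        simpa using ((h1.mul_const B).mul_const N).const_mul (2⁻¹ : ℝ)
      refine squeeze_zero_norm (fun n => ?_) hb
      rw [norm_mul, Real.norm_of_nonneg (by norm_num : (0 : ℝ) ≤ 2⁻¹), Real.norm_eq_abs]
      exact mul_le_mul_of_nonneg_left (hflux n σ hσ') (by norm_num)
    have h1 := tendsto_integral_cutoff_mul (hI1 σ hσ')
    have h2 := tendsto_integral_cutoff_mul (hI2 σ hσ')
    have hsum := hf.add (h1.add h2)
    rw [zero_add] at hsum
    refine hsum.congr fun n => ?_
    simp only [hH, e1, e2]
  -- uniform bound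
  set K : ℝ := 2⁻¹ * (C * B * N) + (q / 2 * B * N + (M + M * B) * N) with hK
  have hHbound : ∀ n : ℕ, ∀ σ ∈ Ioo 0 T, ‖H n σ‖ ≤ K := by
    intro n σ hσ
    have hσ' : σ ∈ Icc 0 T := Ioo_subset_Icc_self hσ
    rw [hH, Real.norm_eq_abs]
    refine (abs_add_le _ _).trans (add_le_add ?_ ((abs_add_le _ _).trans (add_le_add ?_ ?_)))
    · rw [abs_mul, abs_of_pos (by norm_num : (0 : ℝ) < 2⁻¹)]
      refine mul_le_mul_of_nonneg_left ((hflux n σ hσ').trans ?_) (by norm_num)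
      have h1 : C / ((n : ℝ) + 1) ≤ C := div_le_self hC0 (by linarith [n.cast_nonneg (α := ℝ)])
      exact mul_le_mul_of_nonneg_right (mul_le_mul_of_nonneg_right h1 hB0) hN0
    · rw [e1]; exact hsrc1 n σ hσ'
    · rw [e2]; exact hsrc2 n σ hσ'
  -- continuity in `σ` (parametric integrals with compactly supported weights)
  have hcontv : ContinuousOn (fun z : ℝ × (EuclideanSpace ℝ (Fin 3)) => v z.1 z.2) (Icc 0 T ×ˢ univ) :=
    hv.smooth_velocity.continuousOn
  have hcontω : ContinuousOn (fun z : ℝ × (EuclideanSpace ℝ (Fin 3)) => curl (v z.1) z.2) (Icc 0 T ×ˢ univ) := by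
    have := (hv.smooth_velocity.isSmoothSpaceTimeOn_vorticity hS).continuousOn
    exact this
  have hcontA : ContinuousOn (fun z : ℝ × (EuclideanSpace ℝ (Fin 3)) => fderiv ℝ (v z.1) z.2) (Icc 0 T ×ˢ univ) :=
    hv.smooth_velocity.continuousOn_fderiv_slice hS
  have hcontΘ : ContinuousOn (fun z : ℝ × (EuclideanSpace ℝ (Fin 3)) => Θ z.1 z.2) (Icc 0 T ×ˢ univ) :=
    hΘ.continuousOn
  have hcontm : ContinuousOn (fun z : ℝ × (EuclideanSpace ℝ (Fin 3)) =>
      FluidPDE.timeDerivWithin (Icc 0 T) Θ z.1 z.2 + fderiv ℝ (Θ z.1) z.2 (v z.1 z.2)) (Icc 0 T ×ˢ univ) :=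
    (hΘ.continuousOn_timeDerivWithin hS).add ((hΘ.continuousOn_fderiv_slice hS).clm_apply hcontv)
  have hcontq : ContinuousOn (fun z : ℝ × (EuclideanSpace ℝ (Fin 3)) => ‖curl (v z.1) z.2‖ ^ q)
      (Icc 0 T ×ˢ univ) := hcontω.norm.rpow_const fun _ _ => Or.inr hq.le
  have hcontst : ContinuousOn (fun z : ℝ × (EuclideanSpace ℝ (Fin 3)) => ‖curl (v z.1) z.2‖ ^ q *
      ⟪‖curl (v z.1) z.2‖⁻¹ • curl (v z.1) z.2, fderiv ℝ (v z.1) z.2 (‖curl (v z.1) z.2‖⁻¹ • curl (v z.1) z.2)⟫)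
      (Icc 0 T ×ˢ univ) := by
    have h := (continuous_qstretch hq).comp_continuousOn (hcontω.prodMk hcontA)
    exact h.congr fun z _ => rfl
  have hHcont : ∀ n : ℕ, ContinuousOn (H n) (Icc 0 T) := by
    intro n
    have hR : (0 : ℝ) < (n : ℝ) + 1 := by positivity
    have h2R : (0 : ℝ) < 2 * ((n : ℝ) + 1) := by positivity
    have hχ1 : ContDiff ℝ 1 (cutoff (E := (EuclideanSpace ℝ (Fin 3))) ((n : ℝ) + 1)) := contDiff_cutoff _
    -- flux piece, with the gradient of `χ_R` localised by `χ_{2R}`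
    have hflux_eq : ∀ σ, (∫ x, fderiv ℝ (cutoff ((n : ℝ) + 1)) x (v σ x) * (Θ σ x ^ 2 * ‖curl (v σ) x‖ ^ q)) =
        ∫ x, cutoff (2 * ((n : ℝ) + 1)) x * (fderiv ℝ (cutoff ((n : ℝ) + 1)) x (v σ x) *
          (Θ σ x ^ 2 * ‖curl (v σ) x‖ ^ q)) := by
      intro σ
      refine integral_congr_ae (Eventually.of_forall fun x => ?_)
      beta_reduce
      by_cases hx : x ∈ closedBall (0 : (EuclideanSpace ℝ (Fin 3))) (2 * ((n : ℝ) + 1))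
      · rw [cutoff_eq_one h2R (mem_closedBall_zero_iff.1 hx), one_mul]
      · simp [fderiv_cutoff_eq_zero hR hx]
    have hfl : ContinuousOn (fun σ => ∫ x, fderiv ℝ (cutoff ((n : ℝ) + 1)) x (v σ x) *
        (Θ σ x ^ 2 * ‖curl (v σ) x‖ ^ q)) (Icc 0 T) := by
      have h' := continuousOn_integral_mul_of_continuousOn (G := fun z : ℝ × (EuclideanSpace ℝ (Fin 3)) =>
          fderiv ℝ (cutoff ((n : ℝ) + 1)) z.2 (v z.1 z.2) * (Θ z.1 z.2 ^ 2 * ‖curl (v z.1) z.2‖ ^ q))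
        (a := 0) (b := T) (contDiff_cutoff (n := 0) (2 * ((n : ℝ) + 1))).continuous (hasCompactSupport_cutoff h2R)
        ((((hχ1.continuous_fderiv one_ne_zero).comp continuous_snd).continuousOn.clm_apply hcontv).mul
          ((hcontΘ.pow 2).mul hcontq))
      exact h'.congr fun σ _ => hflux_eq σ
    have hs1 : ContinuousOn (fun σ => ∫ x, cutoff ((n : ℝ) + 1) x * ((q / 2 * Θ σ x ^ 2) *
        (‖curl (v σ) x‖ ^ q * ⟪‖curl (v σ) x‖⁻¹ • curl (v σ) x,
          fderiv ℝ (v σ) x (‖curl (v σ) x‖⁻¹ • curl (v σ) x)⟫))) (Icc 0 T) :=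
      continuousOn_integral_mul_of_continuousOn (G := fun z : ℝ × (EuclideanSpace ℝ (Fin 3)) =>
          (q / 2 * Θ z.1 z.2 ^ 2) * (‖curl (v z.1) z.2‖ ^ q * ⟪‖curl (v z.1) z.2‖⁻¹ • curl (v z.1) z.2,
            fderiv ℝ (v z.1) z.2 (‖curl (v z.1) z.2‖⁻¹ • curl (v z.1) z.2)⟫))
        (contDiff_cutoff (n := 0) _).continuous (hasCompactSupport_cutoff hR)
        ((continuousOn_const.mul (hcontΘ.pow 2)).mul hcontst)
    have hs2 : ContinuousOn (fun σ => ∫ x, cutoff ((n : ℝ) + 1) x * ((Θ σ x *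
        (FluidPDE.timeDerivWithin (Icc 0 T) Θ σ x + fderiv ℝ (Θ σ) x (v σ x))) * ‖curl (v σ) x‖ ^ q))
        (Icc 0 T) :=
      continuousOn_integral_mul_of_continuousOn (G := fun z : ℝ × (EuclideanSpace ℝ (Fin 3)) =>
          (Θ z.1 z.2 * (FluidPDE.timeDerivWithin (Icc 0 T) Θ z.1 z.2 + fderiv ℝ (Θ z.1) z.2 (v z.1 z.2))) *
            ‖curl (v z.1) z.2‖ ^ q)
        (contDiff_cutoff (n := 0) _).continuous (hasCompactSupport_cutoff hR)
        ((hcontΘ.mul hcontm).mul hcontq)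
    have hsum := (hfl.const_smul (2⁻¹ : ℝ)).add (hs1.add hs2)
    refine hsum.congr fun σ _ => ?_
    simp only [hH, e1, e2, Pi.add_apply, Pi.smul_apply, smul_eq_mul]
  -- dominated convergence in `σ`
  have hRlim : Tendsto (fun n : ℕ => ∫ σ in Ioo 0 T, H n σ) atTop
      (𝓝 (∫ σ in Ioo 0 T, ((∫ x, (q / 2 * Θ σ x ^ 2) * (‖curl (v σ) x‖ ^ q *
          ⟪‖curl (v σ) x‖⁻¹ • curl (v σ) x, fderiv ℝ (v σ) x (‖curl (v σ) x‖⁻¹ • curl (v σ) x)⟫)) +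
        ∫ x, (Θ σ x * (FluidPDE.timeDerivWithin (Icc 0 T) Θ σ x + fderiv ℝ (Θ σ) x (v σ x))) *
          ‖curl (v σ) x‖ ^ q))) := by
    refine tendsto_integral_of_dominated_convergence (fun _ => K) ?_ ?_ ?_ ?_
    · intro n
      exact ((hHcont n).mono Ioo_subset_Icc_self).aestronglyMeasurable measurableSet_Ioo
    · exact integrableOn_const (by simp)
    · intro n
      rw [ae_restrict_iff' measurableSet_Ioo]
      exact Eventually.of_forall fun σ hσ => hHbound n σ hσ
    · rw [ae_restrict_iff' measurableSet_Ioo]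
      exact Eventually.of_forall fun σ hσ => hHlim σ hσ
  have heq : (fun n : ℕ => 2⁻¹ * (∫ x, cutoff ((n : ℝ) + 1) x * (Θ T x ^ 2 * ‖curl (v T) x‖ ^ q)) -
      2⁻¹ * (∫ x, cutoff ((n : ℝ) + 1) x * (Θ 0 x ^ 2 * ‖curl (v 0) x‖ ^ q))) =
      fun n => ∫ σ in Ioo 0 T, H n σ := funext fun n => by rw [hid n]
  rw [heq] at hL
  exact tendsto_nhds_unique hL hRlim

end Whole

end Summit.NavierStokesRegularity.NavierStokesRegularity.Theorems.PowerGaugeEulerLiouville.VorticityDecay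

end
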